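import Mathlib
import HarnessLib

/-!
# Crux `NNLinearDegreeCofactorHard` (stmt-ValiantsHypothesis-23918), line `internal_cofactor`, stub S2b (ii) / rung S11
# (stmt-ValiantsHypothesis-24468): the CONDITIONAL-PROBABILITY SUPERMARTINGALE in counting form

The composition step (F‴) of `Lines/internal_cofactor-S2b-D3plan.md` must price, along every bit string `v : Fin (2J) → Bool`
read pair by pair, a past-chosen sequence of TESTS (pairs with `≥ f` forbidden codes, factor `(4−f)/4`) and GATES (windows of
`ℓ` pairs whose content must hit a past-chosen set of density `≤ C/√ℓ`), the positions, strengths, windows and targets all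
depending on the past.  Every such pricing is an instance of ONE elementary fact: a product of conditional sub-probabilities is a
sub-probability.  In counting form, with a weight `π j v ≥ 0` for pair `j` that depends on `v` only through the bits `< 2j + 2`
(the past AND the pair itself) and satisfies `Σ_{c ∈ Bool × Bool} π j (v[pair j := c]) ≤ 1` for every past:

* `sum_prod_condWeight_le_one` — `Σ_{v} Π_{j<J} π j v ≤ 1`;
* `card_mul_le_one_of_condWeight` — hence `#A · w ≤ 1` whenever every `v ∈ A` has `Π_j π j v ≥ w`.

How (F‴) uses it (no further lemma needed): tests — `π j v := [code_j v ∉ Φ j v] / (4 − #Φ j v)` (sums to `1`; on words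
avoiding every `Φ` the product is `≥ 4^{−(J−r)} (4−f)^{−r}` when `r` pairs have `#Φ ≥ f`, recovering
`AdaptiveBlockTests.card_adaptiveAvoid_le`); gates — inside a past-chosen window with admissible content set `S`, `π j` := the
ratio `N(prefix·c)/N(prefix)` of admissible completions (sums to `1`; on an admissible content the product over the window
is `1/#S`, and `#S ≤ θ·4^ℓ`, e.g. `θ = C/√ℓ` from `PopCountAntiConcentration`, gives the factor `θ` per `4^{−ℓ}`); free
pairs — `π = 1/4`.

Honest framing: elementary counting (measure-agnostic infrastructure); nothing here bears on S11, S2b, the crux or VP ≠ VNP.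
No definitions, no named facts.
-/

-- Sub = Summit single-conjunct layout: the duplicated namespace component is mandated by the tree.
set_option linter.dupNamespace false

namespace Summit.ValiantsHypothesis.ValiantsHypothesis.Theorems.FifoMatching.NNLinearDegreeCofactorHard.CondProb

open Finset

variable {J : ℕ}

/-- Setting pair `t` to the code `c` and then reading pair `t` gives back `c`, and blanking gives back the blank word:
the map `(v̂, c) ↦ v̂[pair t := c]` is injective on words blank at pair `t`. [folklore] -/
theorem setPair_injOn (t : ℕ) (ht : 2 * t + 1 < 2 * J) :
    Set.InjOn (fun p : (Fin (2 * J) → Bool) × (Bool × Bool) => fun k : Fin (2 * J) =>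
        if k.val = 2 * t then p.2.1 else if k.val = 2 * t + 1 then p.2.2 else p.1 k)
      ((((univ : Finset (Fin (2 * J) → Bool)).filter fun v => ∀ i : Fin (2 * J), 2 * t ≤ i.val → v i = false)
        ×ˢ (univ : Finset (Bool × Bool)) : Finset _) : Set ((Fin (2 * J) → Bool) × (Bool × Bool))) := by
  intro p hp q hq hpq
  rw [mem_coe, mem_product, mem_filter] at hp hq
  have e0 := congrFun hpq ⟨2 * t, by omega⟩
  have e1 := congrFun hpq ⟨2 * t + 1, ht⟩
  simp only [if_true, show ¬ (2 * t + 1 = 2 * t) by omega, if_false] at e0 e1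
  apply Prod.ext
  · funext k
    by_cases hk : 2 * t ≤ k.val
    · rw [hp.1.2 k hk, hq.1.2 k hk]
    · have e := congrFun hpq k
      simp only [show ¬ (k.val = 2 * t) by omega, show ¬ (k.val = 2 * t + 1) by omega, if_false] at e
      exact e
  · exact Prod.ext e0 e1

/-- **A product of conditional sub-probabilities is a sub-probability (counting form).**  Let `π j v ≥ 0` depend on the
bit string `v : Fin (2J) → Bool` only through the bits `< 2j + 2`, and suppose that for every `j < J` and every `v` the four
values `π j (v[pair j := c])`, `c ∈ Bool × Bool`, sum to at most `1`.  Then `Σ_v Π_{j<J} π j v ≤ 1`. [folklore] -/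
theorem sum_prod_condWeight_le_one (π : ℕ → (Fin (2 * J) → Bool) → ℝ) (hπ : ∀ j v, 0 ≤ π j v)
    (hmeas : ∀ j (v w : Fin (2 * J) → Bool), (∀ i : Fin (2 * J), i.val < 2 * j + 2 → v i = w i) → π j v = π j w)
    (hsub : ∀ j < J, ∀ v : Fin (2 * J) → Bool,
      ∑ c : Bool × Bool, π j (fun k : Fin (2 * J) =>
        if k.val = 2 * j then c.1 else if k.val = 2 * j + 1 then c.2 else v k) ≤ 1) :
    ∑ v : Fin (2 * J) → Bool, ∏ j ∈ range J, π j v ≤ 1 := by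
  classical
  -- `S t`: the statement for the first `t` pairs on words blank above pair `t`
  suffices S : ∀ t ≤ J, ∑ v ∈ (univ : Finset (Fin (2 * J) → Bool)).filter
      (fun v => ∀ i : Fin (2 * J), 2 * t ≤ i.val → v i = false), ∏ j ∈ range t, π j v ≤ 1 by
    have h := S J le_rfl
    rwa [filter_true_of_mem (fun v _ i hi => absurd i.isLt (not_lt.2 hi))] at h
  intro t
  induction t with
  | zero =>
    intro _
    have hsub1 : ((univ : Finset (Fin (2 * J) → Bool)).filter fun v => ∀ i : Fin (2 * J), 2 * 0 ≤ i.val → v i = false)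
        ⊆ {fun _ => false} := by
      intro v hv
      rw [mem_filter] at hv
      rw [mem_singleton]
      funext i
      exact hv.2 i (Nat.zero_le _)
    calc ∑ v ∈ (univ : Finset (Fin (2 * J) → Bool)).filter
          (fun v => ∀ i : Fin (2 * J), 2 * 0 ≤ i.val → v i = false), ∏ j ∈ range 0, π j v
        ≤ ∑ v ∈ ({fun _ => false} : Finset (Fin (2 * J) → Bool)), ∏ j ∈ range 0, π j v :=
          sum_le_sum_of_subset_of_nonneg hsub1 (fun v _ _ => by simp)
      _ = 1 := by simp
  | succ t ih =>
    intro ht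
    have ht' : 2 * t + 1 < 2 * J := by omega
    set Bt := (univ : Finset (Fin (2 * J) → Bool)).filter
      (fun v => ∀ i : Fin (2 * J), 2 * t ≤ i.val → v i = false) with hBt
    set Bt1 := (univ : Finset (Fin (2 * J) → Bool)).filter
      (fun v => ∀ i : Fin (2 * J), 2 * (t + 1) ≤ i.val → v i = false) with hBt1
    set F : (Fin (2 * J) → Bool) × (Bool × Bool) → (Fin (2 * J) → Bool) := fun p k =>
      if k.val = 2 * t then p.2.1 else if k.val = 2 * t + 1 then p.2.2 else p.1 k with hF
    -- `Bt1` is the image of `Bt × codes` under `F`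
    have himage : Bt1 = (Bt ×ˢ (univ : Finset (Bool × Bool))).image F := by
      ext v
      rw [mem_image]
      constructor
      · intro hv
        rw [hBt1, mem_filter] at hv
        refine ⟨(fun k => if k.val / 2 = t then false else v k, (v ⟨2 * t, by omega⟩, v ⟨2 * t + 1, ht'⟩)), ?_, ?_⟩
        · rw [mem_product, hBt, mem_filter]
          refine ⟨⟨mem_univ _, fun i hi => ?_⟩, mem_univ _⟩
          simp only
          by_cases h : i.val / 2 = t
          · rw [if_pos h]
          · rw [if_neg h]; exact hv.2 i (by omega)
        · funext k
          simp only [hF]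
          by_cases h0 : k.val = 2 * t
          · rw [if_pos h0]; congr 1; exact Fin.ext h0.symm
          · rw [if_neg h0]
            by_cases h1 : k.val = 2 * t + 1
            · rw [if_pos h1]; congr 1; exact Fin.ext h1.symm
            · rw [if_neg h1, if_neg (by omega)]
      · rintro ⟨p, hp, rfl⟩
        rw [mem_product, hBt, mem_filter] at hp
        rw [hBt1, mem_filter]
        refine ⟨mem_univ _, fun i hi => ?_⟩
        simp only [hF]
        rw [if_neg (by omega), if_neg (by omega)]
        exact hp.1.2 i (by omega)
    have hinj : Set.InjOn F ((Bt ×ˢ (univ : Finset (Bool × Bool)) : Finset _) : Set _) := by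
      rw [hF, hBt]; exact setPair_injOn t ht'
    rw [himage, sum_image hinj, sum_product]
    -- on each fibre: the first `t` factors are those of the base word, the last one sums to `≤ 1`
    have hfib : ∀ v ∈ Bt, ∑ c : Bool × Bool, ∏ j ∈ range (t + 1), π j (F (v, c))
        ≤ ∏ j ∈ range t, π j v := by
      intro v _
      have hagree : ∀ c : Bool × Bool, ∀ j < t, π j (F (v, c)) = π j v := by
        intro c j hj
        apply hmeas
        intro i hi
        simp only [hF]
        rw [if_neg (by omega), if_neg (by omega)]
      have hrw : ∀ c : Bool × Bool, ∏ j ∈ range (t + 1), π j (F (v, c))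
          = (∏ j ∈ range t, π j v) * π t (F (v, c)) := by
        intro c
        rw [prod_range_succ, prod_congr rfl fun j hj => hagree c j (mem_range.1 hj)]
      rw [Finset.sum_congr rfl fun c _ => hrw c, ← mul_sum]
      have h1 : ∑ c : Bool × Bool, π t (F (v, c)) ≤ 1 := hsub t (by omega) v
      have h0 : 0 ≤ ∏ j ∈ range t, π j v := prod_nonneg fun j _ => hπ j v
      calc (∏ j ∈ range t, π j v) * ∑ c : Bool × Bool, π t (F (v, c))
          ≤ (∏ j ∈ range t, π j v) * 1 := mul_le_mul_of_nonneg_left h1 h0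
        _ = ∏ j ∈ range t, π j v := mul_one _
    exact (sum_le_sum hfib).trans (ih (by omega))

/-- **Pricing a set of words.**  Under the hypotheses of `sum_prod_condWeight_le_one`, if every word of `A` has conditional
weight product `≥ w ≥ 0`, then `#A · w ≤ 1`. [folklore] -/
theorem card_mul_le_one_of_condWeight (π : ℕ → (Fin (2 * J) → Bool) → ℝ) (hπ : ∀ j v, 0 ≤ π j v)
    (hmeas : ∀ j (v w : Fin (2 * J) → Bool), (∀ i : Fin (2 * J), i.val < 2 * j + 2 → v i = w i) → π j v = π j w)
    (hsub : ∀ j < J, ∀ v : Fin (2 * J) → Bool,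
      ∑ c : Bool × Bool, π j (fun k : Fin (2 * J) =>
        if k.val = 2 * j then c.1 else if k.val = 2 * j + 1 then c.2 else v k) ≤ 1)
    (A : Finset (Fin (2 * J) → Bool)) (w : ℝ) (hA : ∀ v ∈ A, w ≤ ∏ j ∈ range J, π j v) :
    (A.card : ℝ) * w ≤ 1 := by
  classical
  calc (A.card : ℝ) * w = ∑ v ∈ A, w := by rw [sum_const, nsmul_eq_mul]
    _ ≤ ∑ v ∈ A, ∏ j ∈ range J, π j v := sum_le_sum hA
    _ ≤ ∑ v : Fin (2 * J) → Bool, ∏ j ∈ range J, π j v :=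
        sum_le_sum_of_subset_of_nonneg (subset_univ A) (fun v _ _ => prod_nonneg fun j _ => hπ j v)
    _ ≤ 1 := sum_prod_condWeight_le_one π hπ hmeas hsub

end Summit.ValiantsHypothesis.ValiantsHypothesis.Theorems.FifoMatching.NNLinearDegreeCofactorHard.CondProb
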